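import Summits.QuantumFields.BalabanUV.Beta.D1BFx.NeedleRowGlueS
import Summits.QuantumFields.BalabanUV.Beta.D1BFx.AssemblyEndRecutS
import Summits.QuantumFields.BalabanUV.Beta.D1BFx.RoadEndBFxRows

/-!
# `BalabanUV.Beta.D1BFx.RoadEndBFxRowsS` — road «BF-x» for binder row D1, slot (K), «END-ROWS-S»: THE `hGrp` HYPOTHESIS OF THE «ENDₛ» END FOR THE LABEL OF
# RECORD `grpRec`, TWO-PROFILE RE-CUT TABLE `restKS (gfrz n a b) (s n • gfrz n a b)` (END-ii-SPEC v1.1 §3 (b)), FROM THE THREE GROUP ROWS — (LOCAL) one bound per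
# local word, (Λ) the record's Λ row VERBATIM (no ghost word is a Λ-word), (N) the eight profile-free table rows through `NeedleRowGlueS`

HONEST DEPENDENCY (page 1, mandatory): continuum YM on T⁴ ⇐ BetaPertH ∧ nine spine estimates (0/9 proved); BetaPertH ⇐ (D1) ∧ (D4) ∧
CAP+tail; G-an2-4 gates asym, D1 and NE2/3/4.  HONEST FRAMING (cell contract, verbatim): «discharging `BetaPertH` makes Bałaban's UV
stability UNCONDITIONAL — a real constructive-QFT result; it is NOT the continuum limit and NOT the Clay problem.»  THIS MODULE DISCHARGES
NOTHING of the wall: [folklore] bookkeeping BY NAME — `RoadEndBFxRows` (owner gen 9: `grpRec`, `localFibre`, `cgRec`, the fibre lemmas) re-wired over the two-profile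
table: the LOCAL row via `AssemblyEndRecutS.conv_recutS`, the Λ row via `RoadEndLamRow.abs_gLam_row_le_zero_of_letters` (transferred through the rfl identity
`sum_lamFibre_restKS_eq`), the needle row via `NeedleRowGlueS.abs_gN_row_le_of_tablesS`.  No `def` (the record's `cgRec` is reused), nothing cited, 0 sorry.
NOTHING is estimated here.  0 wall binders (root-level hW ∕ hR-sockets ∕ hSX-socket ∕ D1Tel ∕ D1Rep — 0); (K) NOT closed; NOT D1, NOT `BetaPertH`, NOT continuum, NOT Clay.

ABSOLUTE RULE (cell charter, verbatim): «No internally-minted statement may enter as a cited fact. Every hypothesis is either kernel-proved in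
this package or a verbatim quotation of a PUBLISHED theorem with page reference. The manuscript(s) under audit are NOT citable for their own
disputed steps — they are the thing under adjudication; programme-internal (2001/route/tribunal) claims are never citable.»

CONTENT.
* §1 [folklore] `sum_lamFibre_restKS_eq`, `sum_grpRec_one_restKS_eq` — the Λ group of the two-profile table is the record's.
* §2 [folklore] **`abs_gLoc_row_le_of_wordsS`** — the LOCAL group row from per-word rows (two-profile words, scalar `s`).
* §3 [folklore] **`hGrp_of_rowsS`** — `hGrp` of `RoadEndBFxTotalShellGroupsS.d1Drift_BFx_total_shell_of_prop12_of_groupsS` at `grp := grpRec`, `g₀ := 3`,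
  `CG := cgRec CL C₁ … C₈`, from `hLoc` (two-profile words), the Λ data of record, and the eight table rows `h₁ … h₈` (profile-free).
Unit `b2b-balaban-beta-d1-p2` (gen 12), road «BF-x» OWNER; `LEAVES-BFx.md` row «END-ROWS-S»; END-ii-SPEC v1.1 §3 (b).
-/

noncomputable section

open Finset Filter Topology
open scoped BigOperators
open Literature.MathematicalPhysics.QuantumFieldTheory.Balaban1983to89
open Literature.MathematicalPhysics.QuantumFieldTheory.Balaban1983to89.Beta
open WindowIdentification (fullSum psum)
open B12Sec2to5 (l1)
open DyadicShell (Pt toReal)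
open ExpKernelCalculus (Site MKer BiLoc shiftK comp)
open DressedMomentNormalisation (resSite)
open OneStepResolventKernel (KInv)
open InterLevelTransport (onLat)
open BalabanStepJets (lamCoeffOf)
open AveragingHessianKernels (hessFF)
open KernelWard (divV)
open Summit.QuantumFields.BalabanUV.Beta.TameKernelCalculus (Spr Loc trK)
open Summit.QuantumFields.BalabanUV.Beta.D1BFx.GluonLeg (Ga)
open Summit.QuantumFields.BalabanUV.Beta.D1BFx.GhostLeg (Ggh)
open Summit.QuantumFields.BalabanUV.Beta.D1BFx.GhostStencil (ghCur)
open Summit.QuantumFields.BalabanUV.Beta.D1BFx.GhostStencilRooted (qAntiAt)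
open Summit.QuantumFields.BalabanUV.Beta.D1BFx.GhostStencilRootedReflection (ctrHalf)
open Summit.QuantumFields.BalabanUV.Beta.D1BFx.ReducedKernel (TableR)
open Summit.QuantumFields.BalabanUV.Beta.D1BFx.DressedTadpoleTable (tadpoleTable)
open Summit.QuantumFields.BalabanUV.Beta.D1BFx.DressedTablesLeg (tadpoleTableA)
open Summit.QuantumFields.BalabanUV.Beta.D1BFx.FineHessianSectors (biBubbleTable)
open Summit.QuantumFields.BalabanUV.Beta.D1BFx.SectorRecut (SbT SbRc)
open Summit.QuantumFields.BalabanUV.Beta.D1BFx.FineStencilBF (ffOf)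
open Summit.QuantumFields.BalabanUV.Beta.D1BFx.FineStencilBFBalaban (SbfBal)
open Summit.QuantumFields.BalabanUV.Beta.D1BFx.GhostAveragingSquare (WghAt)
open Summit.QuantumFields.BalabanUV.Beta.D1BFx.FrozenLegProfile (gfrz decay_gfrz)
open Summit.QuantumFields.BalabanUV.Beta.D1BFx.SplitInstance (RestIdx)
open Summit.QuantumFields.BalabanUV.Beta.D1BFx.SplitRecut (restK')
open Summit.QuantumFields.BalabanUV.Beta.D1BFx.SplitInstanceS (restKS)
open Summit.QuantumFields.BalabanUV.Beta.D1BFx.RoadEndBFxRecut (cornerIdx)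
open Summit.QuantumFields.BalabanUV.Beta.D1BFx.Assembly (fullSum_finset_sum)
open Summit.QuantumFields.BalabanUV.Beta.D1BFx.AssemblyEndRecutS (conv_recutS)
open Summit.QuantumFields.BalabanUV.Beta.D1BFx.LamGroupPointwise (lamFibre not_mem_lamFibre_inr_inr)
open Summit.QuantumFields.BalabanUV.Beta.D1BFx.NeedleGroupPointwise (needleFibre' not_mem_needleFibre'_last disjoint_lamFibre_needleFibre')
open Summit.QuantumFields.BalabanUV.Beta.D1BFx.RoadEndLamRow (abs_gLam_row_le_zero_of_letters)
open Summit.QuantumFields.BalabanUV.Beta.D1BFx.NeedleRowGlueS (abs_gN_row_le_of_tablesS)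
open Summit.QuantumFields.BalabanUV.Beta.D1BFx.RoadEndBFxRows (grpRec localFibre cgRec cgRec_zero cgRec_one cgRec_two filter_grpRec_eq_zero filter_grpRec_eq_one
  grpRec_eq_two_iff)

namespace Summit.QuantumFields.BalabanUV.Beta.D1BFx.RoadEndBFxRowsS

/-! ## §1 The Λ-group of the two-profile table is the record's (no ghost word is a Λ-word) -/

section Lam

variable (n : ℕ) [NeZero n] (a : ℝ) {g g' : Pt → ℝ} (cE cΛ cR cK cQ cE₂ cJ4 cΛ₂ cR₂ cQ₂ x₀ ωgl ωgh lam N : ℝ) {WE WJ WΛ WR WQ : TableR} {μ ν : Fin 4}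

/-- [folklore] On the Λ fibre the two-profile table IS the table of record at the first profile: `lamFibre` holds gluon words only (`not_mem_lamFibre_inr_inr`),
and on those ranges `restKS g g' = restK' g` definitionally. -/
theorem sum_lamFibre_restKS_eq (g' : Pt → ℝ) (b w : Pt) :
    ∑ τ ∈ lamFibre, restKS n a g g' cE cΛ cR cK cQ cE₂ cJ4 cΛ₂ cR₂ cQ₂ x₀ WE WJ WΛ WR WQ ωgl ωgh lam N μ ν b τ w
      = ∑ τ ∈ lamFibre, restK' n a g cE cΛ cR cK cQ cE₂ cJ4 cΛ₂ cR₂ cQ₂ x₀ WE WJ WΛ WR WQ ωgl ωgh lam N μ ν b τ w := by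
  refine sum_congr rfl fun τ hτ => ?_
  rcases τ with x | x | y
  · rfl
  · rfl
  · exact absurd hτ (not_mem_lamFibre_inr_inr y)

end Lam

/-- [folklore] The same along the block sizes at the frozen profile of record, in the END's currency and for the label of record (`filter_grpRec_eq_one`),
as an equality of the full-sum integrands. -/
theorem sum_grpRec_one_restKS_eq (n : ℕ) [NeZero n] (a : ℝ) {N : ℝ} {μ ν : Fin 4} {cE cΛ cR cK cQ cE₂ cJ4 cΛ₂ cR₂ cQ₂ x₀ ωgl ωgh : ℕ → ℝ}
    {WE WJ WΛ WR WQ : ℕ → TableR} {s : ℕ → ℝ} (b : Pt) :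
    (fun w : Pt => ∑ τ ∈ (univ : Finset RestIdx).filter (fun τ => grpRec τ = 1),
        restK' n a (gfrz n a b) (cE n) (cΛ n) (cR n) (cK n) (cQ n) (cE₂ n) (cJ4 n) (cΛ₂ n) (cR₂ n) (cQ₂ n) (x₀ n)
          (WE n) (WJ n) (WΛ n) (WR n) (WQ n) (ωgl n) (ωgh n) ((n : ℝ) ^ 8) N μ ν b τ w)
      = fun w : Pt => ∑ τ ∈ (univ : Finset RestIdx).filter (fun τ => grpRec τ = 1),
        restKS n a (gfrz n a b) (fun v => s n * gfrz n a b v) (cE n) (cΛ n) (cR n) (cK n) (cQ n) (cE₂ n) (cJ4 n) (cΛ₂ n) (cR₂ n) (cQ₂ n) (x₀ n)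
          (WE n) (WJ n) (WΛ n) (WR n) (WQ n) (ωgl n) (ωgh n) ((n : ℝ) ^ 8) N μ ν b τ w := by
  funext w
  rw [filter_grpRec_eq_one, sum_lamFibre_restKS_eq]

/-! ## §2 The LOCAL group row of the two-profile table from one bound per local word, at a fixed block size -/

section Fixed

variable (n : ℕ) [NeZero n] (a : ℝ) {gp : Pt → Pt → ℝ} (cE cΛ cR cK cQ cE₂ cJ4 cΛ₂ cR₂ cQ₂ x₀ ωgl ωgh lam N : ℝ) {WE WJ WΛ WR WQ : TableR}
  {μ ν : Fin 4} {CE CJ CΛt CRt CQ δW : ℝ} (s : ℝ)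

/-- [folklore] **THE LOCAL GROUP ROW OF THE TWO-PROFILE TABLE FROM PER-WORD ROWS** (`restKS (gp b) (s•gp b)`, any scalar `s`; site-dependent profile `gp b`
exponentially bounded; the (CONV) data of `AssemblyEndRecutS.conv_recutS`:
`0 < a`, `Spr (Ga n a)`, the five slot tables bi-localised at one rate, `μ ≠ ν`): one bound `CL τ` per local word gives the group bound `Σ_{τ ∈ localFibre} CL τ`. -/
theorem abs_gLoc_row_le_of_wordsS (ha : 0 < a) (hGa : Spr (Ga n a))
    (hg : ∀ b : Pt, ∃ C δ : ℝ, 0 < δ ∧ ∀ v, |gp b v| ≤ C * Real.exp (-δ * l1 v)) (hδW : 0 < δW)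
    (hE : ∀ κ u l u', BiLoc (WE κ u l u') u u' CE δW) (hJ : ∀ κ u l u', BiLoc (WJ κ u l u') u u' CJ δW)
    (hΛ : ∀ κ u l u', BiLoc (WΛ κ u l u') u u' CΛt δW) (hR : ∀ κ u l u', BiLoc (WR κ u l u') u u' CRt δW)
    (hQ : ∀ κ u l u', BiLoc (WQ κ u l u') u u' CQ δW) (hμν : μ ≠ ν) {CL : RestIdx → ℝ}
    (hLoc : ∀ τ ∈ localFibre, |∑ b ∈ (univ : Finset (Fin 4 → Fin n)).image resSite, ((n : ℝ) ^ 4)⁻¹ *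
      fullSum (fun w : Pt => restKS n a (gp b) (fun v => s * gp b v) cE cΛ cR cK cQ cE₂ cJ4 cΛ₂ cR₂ cQ₂ x₀ WE WJ WΛ WR WQ ωgl ωgh lam N μ ν b τ w)| ≤ CL τ) :
    |∑ b ∈ (univ : Finset (Fin 4 → Fin n)).image resSite, ((n : ℝ) ^ 4)⁻¹ *
      fullSum (fun w : Pt => ∑ τ ∈ (univ : Finset RestIdx).filter (fun τ => grpRec τ = 0),
        restKS n a (gp b) (fun v => s * gp b v) cE cΛ cR cK cQ cE₂ cJ4 cΛ₂ cR₂ cQ₂ x₀ WE WJ WΛ WR WQ ωgl ωgh lam N μ ν b τ w)|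
      ≤ ∑ τ ∈ localFibre, CL τ := by
  rw [filter_grpRec_eq_zero]
  have hfs : ∀ b ∈ (univ : Finset (Fin 4 → Fin n)).image resSite,
      fullSum (fun w : Pt => ∑ τ ∈ localFibre, restKS n a (gp b) (fun v => s * gp b v) cE cΛ cR cK cQ cE₂ cJ4 cΛ₂ cR₂ cQ₂ x₀ WE WJ WΛ WR WQ ωgl ωgh lam N μ ν b τ w)
        = ∑ τ ∈ localFibre, fullSum (fun w : Pt => restKS n a (gp b) (fun v => s * gp b v) cE cΛ cR cK cQ cE₂ cJ4 cΛ₂ cR₂ cQ₂ x₀ WE WJ WΛ WR WQ ωgl ωgh lam N μ ν b τ w) := by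
    intro b _
    obtain ⟨C', δ', hδ', hgb⟩ := hg b
    exact fullSum_finset_sum _ fun τ _ =>
      conv_recutS n a cE cΛ cR cK cQ cE₂ cJ4 cΛ₂ cR₂ cQ₂ x₀ ωgl ωgh lam N b ha hGa hδ' hgb hδW hE hJ hΛ hR hQ hμν s τ
  rw [sum_congr rfl fun b hb => by rw [hfs b hb, mul_sum], sum_comm]
  exact (abs_sum_le_sum_abs _ _).trans (sum_le_sum fun τ hτ => hLoc τ hτ)

end Fixed

/-! ## §3 In the END's currency: `hGrp` for the label of record, two-profile table, from the three rows -/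

section Packaged

variable {a N : ℝ} {μ ν : Fin 4} {cE cVH cΛ cR cK cQ cE₂ cJ4 cΛ₂ cR₂ cQ₂ x₀ ωgl ωgh : ℕ → ℝ} {WE WJ WΛ WR WQ : ℕ → TableR}
  {CE CJ CΛt CRt CQ δW : ℕ → ℝ}
  {TΛ WA : ℕ → Fin 4 → Site 4 → Fin 4 → Site 4 → MKer 4 (Fin 4)} {CT δT : ℕ → ℝ}
  {ε : ℕ → ℝ} {X : ℕ → Site 4 → MKer 4 (Fin 4)} {Cx δx : ℕ → ℝ}

/-- [folklore] **ROAD BF-x, THE `hGrp` HYPOTHESIS OF THE «ENDₛ» END FOR THE LABEL OF RECORD, FROM THE THREE ROWS** (owner «END-ROWS-S»; two-profile words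
`restKS (gfrz n a b) (s n • gfrz n a b)`, ANY family `s : ℕ → ℝ`).  Displayed and NOT
proved here: the ENDs' common data (`0 < a`, `μ ≠ ν`, `Spr (Ga n a)` along `n`, the five slot tables bi-localised); (LOCAL) one n-uniform bound per local word
`hLoc`; (Λ) the Λ₂-slot structure sockets `hdec`∕`hTloc`∕`hWAa`∕`hWAl`∕`hTcov` and the zero-momentum data `cΛ n ≠ 0`, `ε n = ±1`, `hX`, the covariance letters
(W1) for `ε n • SbfBal` and (W2′) for `−(ε n·cΛ₂ n∕cΛ n) • TΛ n m 0` — as in `RoadEndLamRow.abs_gLam_row_le_zero_of_letters`, along `n`; (N) the eight table rows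
`h₁ … h₈` of `NeedleRowGlueS.abs_gN_row_le_of_tablesS` (profile-free tables).  Conclusion: `hGrp` of `RoadEndBFxTotalShellGroupsS.d1Drift_BFx_total_shell_of_prop12_of_groupsS` at
`grp := grpRec`, `g₀ := 3`, `CG := cgRec CL C₁ … C₈` (together with `hcorner := grpRec_eq_three_iff`).  NOTHING is estimated here. -/
theorem hGrp_of_rowsS (ha : 0 < a) (hμν : μ ≠ ν) (hGa : ∀ n : ℕ, 2 ≤ n → ∀ [NeZero n], Spr (Ga n a)) (hδW : ∀ n, 0 < δW n)
    (hE : ∀ n κ u l u', BiLoc (WE n κ u l u') u u' (CE n) (δW n)) (hJ : ∀ n κ u l u', BiLoc (WJ n κ u l u') u u' (CJ n) (δW n))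
    (hΛ : ∀ n κ u l u', BiLoc (WΛ n κ u l u') u u' (CΛt n) (δW n)) (hR : ∀ n κ u l u', BiLoc (WR n κ u l u') u u' (CRt n) (δW n))
    (hQ : ∀ n κ u l u', BiLoc (WQ n κ u l u') u u' (CQ n) (δW n))
    -- the scalar family of the two-profile table; (LOCAL) one n-uniform bound per local word
    (s : ℕ → ℝ) {CL : RestIdx → ℝ}
    (hLoc : ∀ n : ℕ, 2 ≤ n → ∀ [NeZero n], ∀ τ ∈ localFibre, |∑ b ∈ (univ : Finset (Fin 4 → Fin n)).image resSite, ((n : ℝ) ^ 4)⁻¹ *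
      fullSum (fun w : Pt => restKS n a (gfrz n a b) (fun v => s n * gfrz n a b v) (cE n) (cΛ n) (cR n) (cK n) (cQ n) (cE₂ n) (cJ4 n) (cΛ₂ n) (cR₂ n) (cQ₂ n) (x₀ n)
        (WE n) (WJ n) (WΛ n) (WR n) (WQ n) (ωgl n) (ωgh n) ((n : ℝ) ^ 8) N μ ν b τ w)| ≤ CL τ)
    -- (Λ) the Λ₂-slot structure sockets, along `n`
    (hδT : ∀ n, 0 < δT n)
    (hdec : ∀ n : ℕ, 2 ≤ n → ∀ [NeZero n], ∀ κ u l u', WΛ n κ u l u' =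
      (∑ m : Fin 4, OneStepResolventKernel.wsum (onLat n (fun y => lamCoeffOf (KInv (N := n) (d := 3)) n m y l u'))
          (fun v => onLat n (fun y => TΛ n m y κ u) v))
      + (∑ m : Fin 4, OneStepResolventKernel.wsum (onLat n (fun y => lamCoeffOf (KInv (N := n) (d := 3)) n m y κ u))
          (fun v => onLat n (fun y => TΛ n m y l u') v))
      + WA n κ u l u')
    (hTloc : ∀ (n : ℕ) m y κ u, BiLoc (TΛ n m y κ u) ((n : ℤ) • y) ((n : ℤ) • y) (CT n * Real.exp (-δT n * l1 ((n : ℤ) • y - u))) (δT n))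
    (hWAa : ∀ n κ u l u', trK (WA n κ u l u') = -WA n κ u l u') (hWAl : ∀ n κ u l u', Loc (WA n κ u l u'))
    (hTcov : ∀ (n : ℕ) m y κ u t, TΛ n m (y + t) κ (u + (n : ℤ) • t) = shiftK (-((n : ℤ) • t)) (TΛ n m y κ u))
    -- (Λ) the zero-momentum data: `cΛ ≠ 0`, `ε = ±1`, the generator's localisation, the covariance letters (W1), (W2′), along `n`
    (hcΛ : ∀ n : ℕ, 2 ≤ n → cΛ n ≠ 0) (hε : ∀ n : ℕ, ε n = 1 ∨ ε n = -1) (hδx : ∀ n, 0 < δx n) (hX : ∀ n u, BiLoc (X n u) u u (Cx n) (δx n))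
    (hW1 : ∀ n : ℕ, 2 ≤ n → ∀ [NeZero n], ∀ u,
      comp (comp (Ga n a) (divV (fun κ v => ε n • SbfBal n a (cE n) (cVH n) (cΛ n) (cR n) (cK n) (cQ n) κ v) u)) (Ga n a) =
        comp (Ga n a) (X n u) - comp (X n u) (Ga n a))
    (hW2 : ∀ n : ℕ, 2 ≤ n → ∀ [NeZero n], ∀ (m : Fin 4) (u : Site 4),
      divV (fun κ v => (-(ε n * (cΛ₂ n / cΛ n))) • TΛ n m 0 κ v) u = comp (X n u) (ffOf (hessFF n m 0)) - comp (ffOf (hessFF n m 0)) (X n u))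
    -- (N) the eight needle table rows
    {C₁ C₂ C₃ C₄ C₅ C₆ C₇ C₈ : ℝ}
    (h₁ : ∀ n : ℕ, 2 ≤ n → ∀ [NeZero n], |ωgl n * cE n * ∑ b ∈ (univ : Finset (Fin 4 → Fin n)).image resSite, ((n : ℝ) ^ 4)⁻¹ * (((n : ℝ) ^ 8)⁻¹ *
      fullSum (fun w : Pt => toReal w μ * toReal w ν *
        biBubbleTable (Ga n a) (Ga n a) SbT (SbRc n a (cE n) (cR n) (cK n) (cQ n)) μ ν (b + w) b))| ≤ C₁)
    (h₂ : ∀ n : ℕ, 2 ≤ n → ∀ [NeZero n], |ωgl n * cE n * ∑ b ∈ (univ : Finset (Fin 4 → Fin n)).image resSite, ((n : ℝ) ^ 4)⁻¹ * (((n : ℝ) ^ 8)⁻¹ *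
      fullSum (fun w : Pt => toReal w μ * toReal w ν *
        biBubbleTable (Ga n a) (Ga n a) (SbRc n a (cE n) (cR n) (cK n) (cQ n)) SbT μ ν (b + w) b))| ≤ C₂)
    (h₃ : ∀ n : ℕ, 2 ≤ n → ∀ [NeZero n], |ωgl n * ∑ b ∈ (univ : Finset (Fin 4 → Fin n)).image resSite, ((n : ℝ) ^ 4)⁻¹ * (((n : ℝ) ^ 8)⁻¹ *
      fullSum (fun w : Pt => toReal w μ * toReal w ν *
        biBubbleTable (Ga n a) (Ga n a) (SbRc n a (cE n) (cR n) (cK n) (cQ n)) (SbRc n a (cE n) (cR n) (cK n) (cQ n)) μ ν (b + w) b))| ≤ C₃)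
    (h₄ : ∀ n : ℕ, 2 ≤ n → ∀ [NeZero n], |ωgh n * (cK n * cQ n) * ∑ b ∈ (univ : Finset (Fin 4 → Fin n)).image resSite, ((n : ℝ) ^ 4)⁻¹ *
      (((n : ℝ) ^ 8)⁻¹ * fullSum (fun w : Pt => toReal w μ * toReal w ν *
        biBubbleTable (Ggh n a) (Ggh n a) ghCur (qAntiAt (ctrHalf n) n) μ ν (b + w) b))| ≤ C₄)
    (h₅ : ∀ n : ℕ, 2 ≤ n → ∀ [NeZero n], |ωgh n * (cQ n * cK n) * ∑ b ∈ (univ : Finset (Fin 4 → Fin n)).image resSite, ((n : ℝ) ^ 4)⁻¹ *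
      (((n : ℝ) ^ 8)⁻¹ * fullSum (fun w : Pt => toReal w μ * toReal w ν *
        biBubbleTable (Ggh n a) (Ggh n a) (qAntiAt (ctrHalf n) n) ghCur μ ν (b + w) b))| ≤ C₅)
    (h₆ : ∀ n : ℕ, 2 ≤ n → ∀ [NeZero n], |ωgh n * (cQ n * cQ n) * ∑ b ∈ (univ : Finset (Fin 4 → Fin n)).image resSite, ((n : ℝ) ^ 4)⁻¹ *
      (((n : ℝ) ^ 8)⁻¹ * fullSum (fun w : Pt => toReal w μ * toReal w ν *
        biBubbleTable (Ggh n a) (Ggh n a) (qAntiAt (ctrHalf n) n) (qAntiAt (ctrHalf n) n) μ ν (b + w) b))| ≤ C₆)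
    (h₇ : ∀ n : ℕ, 2 ≤ n → ∀ [NeZero n], |ωgh n * ∑ b ∈ (univ : Finset (Fin 4 → Fin n)).image resSite, ((n : ℝ) ^ 4)⁻¹ * (((n : ℝ) ^ 8)⁻¹ *
      fullSum (fun w : Pt => toReal w μ * toReal w ν *
        tadpoleTableA (Ggh n a) (WghAt (ctrHalf n) n (x₀ n) (cK n) (cQ n)) μ ν (b + w) b))| ≤ C₇)
    (h₈ : ∀ n : ℕ, 2 ≤ n → ∀ [NeZero n], |ωgl n * cQ₂ n * ∑ b ∈ (univ : Finset (Fin 4 → Fin n)).image resSite, ((n : ℝ) ^ 4)⁻¹ * (((n : ℝ) ^ 8)⁻¹ *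
      fullSum (fun w : Pt => toReal w μ * toReal w ν * tadpoleTable n a (WQ n) μ ν (b + w) b))| ≤ C₈) :
    ∀ n : ℕ, 2 ≤ n → ∀ [NeZero n], ∀ g : Fin 4, g ≠ 3 →
      |∑ b ∈ (univ : Finset (Fin 4 → Fin n)).image resSite, ((n : ℝ) ^ 4)⁻¹ *
        fullSum (fun w : Pt => ∑ τ ∈ (univ : Finset RestIdx).filter (fun τ => grpRec τ = g),
          restKS n a (gfrz n a b) (fun v => s n * gfrz n a b v) (cE n) (cΛ n) (cR n) (cK n) (cQ n) (cE₂ n) (cJ4 n) (cΛ₂ n) (cR₂ n) (cQ₂ n) (x₀ n)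
            (WE n) (WJ n) (WΛ n) (WR n) (WQ n) (ωgl n) (ωgh n) ((n : ℝ) ^ 8) N μ ν b τ w)| ≤ cgRec CL C₁ C₂ C₃ C₄ C₅ C₆ C₇ C₈ g := by
  intro n hn _
  -- (LOCAL)
  have h0 := abs_gLoc_row_le_of_wordsS n a (cE n) (cΛ n) (cR n) (cK n) (cQ n) (cE₂ n) (cJ4 n) (cΛ₂ n) (cR₂ n) (cQ₂ n) (x₀ n) (ωgl n) (ωgh n)
    ((n : ℝ) ^ 8) N (s n) ha (hGa n hn) (fun b => decay_gfrz (hGa n hn) b) (hδW n) (hE n) (hJ n) (hΛ n) (hR n) (hQ n) hμν (hLoc n hn)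
  -- (G_Λ)
  have h1 := abs_gLam_row_le_zero_of_letters n a (cE n) (cVH n) (cΛ n) (cR n) (cK n) (cQ n) (cE₂ n) (cJ4 n) (cΛ₂ n) (cR₂ n) (cQ₂ n) (x₀ n)
    (WE n) (WJ n) (WΛ n) (WR n) (WQ n) (ωgl n) (ωgh n) ((n : ℝ) ^ 8) N μ ν ha (hGa n hn) (hδW n) (hΛ n) (hδT n) (hdec n hn) (hTloc n)
    (hWAa n) (hWAl n) (hTcov n) (hcΛ n hn) (hε n) (hδx n) (hX n) (hW1 n hn) (hW2 n hn) filter_grpRec_eq_one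
  simp_rw [sum_grpRec_one_restKS_eq n a (s := s)] at h1
  -- (NEEDLES ∪ G_R)
  have h2 := abs_gN_row_le_of_tablesS (N := N) (cΛ := cΛ) (cE₂ := cE₂) (cJ4 := cJ4) (cΛ₂ := cΛ₂) (cR₂ := cR₂) (WE := WE) (WJ := WJ)
    (WΛ := WΛ) (WR := WR) grpRec_eq_two_iff ha hGa hδW hQ s h₁ h₂ h₃ h₄ h₅ h₆ h₇ h₈ n hn
  rw [← cgRec_zero CL C₁ C₂ C₃ C₄ C₅ C₆ C₇ C₈] at h0
  rw [← cgRec_one CL C₁ C₂ C₃ C₄ C₅ C₆ C₇ C₈] at h1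
  rw [← cgRec_two CL C₁ C₂ C₃ C₄ C₅ C₆ C₇ C₈] at h2
  intro g hg
  fin_cases g
  · exact h0
  · exact h1
  · exact h2
  · exact absurd rfl hg

end Packaged

end Summit.QuantumFields.BalabanUV.Beta.D1BFx.RoadEndBFxRowsS

end
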